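import Mathlib.Analysis.Convex.Integral
import Mathlib.Analysis.SpecialFunctions.Log.Deriv
import Literature.Analysis.Complex.LittlewoodLemma
import HarnessLib

/-!
# Zero counting from a mean square: Littlewood's lemma and Jensen's inequality

Trunk T-ANALYSIS support (complex analysis, `Literature/Analysis/Complex`). The standard use of
Littlewood's lemma (`Literature.Analysis.Complex.littlewood_lemma`, Titchmarsh §9.9) in
zero-density estimates (Titchmarsh, *The Theory of the Riemann Zeta-Function*, §9.15–9.17 and
§9.24; Selberg 1946): a bound for the mean square of `f` on the left edge of a rectangle bounds
`∫ log‖f‖` there by the concavity of the logarithm, hence bounds the zeros of `f` inside the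
rectangle weighted by their distance from the left edge, hence their number to the right of any
abscissa.

## Main results (all proved)

* `Literature.Analysis.Complex.integral_log_le_mul_log_average` — Jensen's inequality for the
  logarithm on an interval: for `g > 0` continuous on `[c,d]`,
  `∫_c^d log g ≤ (d − c) log((d − c)⁻¹ ∫_c^d g)`.
* `Literature.Analysis.Complex.integral_log_norm_le_of_sq_integral_le` — hence
  `∫_c^d log‖F(y)‖ dy ≤ ((d − c)/2) log M` whenever `∫_c^d ‖F‖² ≤ (d − c) M` (`F` continuous and
  non-vanishing).
* `Literature.Analysis.Complex.littlewood_sum_le_of_sq_integral_le` — **the zero-density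
  skeleton** (Titchmarsh §9.16, first half): for `f` analytic on `[a,b] × [c,d]`, non-zero on the
  boundary, with `∫_c^d ‖f(a+iy)‖² dy ≤ (d − c) M`, `‖f‖ ≥ m₀ > 0` on the right edge, and changes
  of argument bounded by `A` (horizontal edges) and `B` (right edge),
  `2π Σ_{ρ ∈ R°} m(ρ)(Re ρ − a) ≤ (d − c)(½ log M − log m₀) + (b − a)(2A + B)`.
* `Literature.Analysis.Complex.sum_order_le_of_sq_integral_le` — and therefore, for `a < σ < b`,
  the number of zeros (with multiplicity) in `[σ, b) × (c, d)` is at most that bound divided by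
  `2π(σ − a)`.

## References

* E. C. Titchmarsh, *The Theory of the Riemann Zeta-Function*, 2nd ed. revised by
  D. R. Heath-Brown, OUP 1986, §9.9 (9.9.1), §9.16 (proof of Thm. 9.16). [key `Titchmarsh1986`]
* A. Selberg, *Contributions to the theory of the Riemann zeta-function*, Arch. Math. Naturvid.
  48 (1946), no. 5, 89–155, §3.
-/

noncomputable section

open Complex Set MeasureTheory Filter Topology intervalIntegral

namespace Literature.Analysis.Complex

variable {a b c d : ℝ}

/-! ### Jensen's inequality for the logarithm on an interval -/

/-- **Jensen's inequality for `log` on an interval.** If `g` is continuous and positive on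
`[c,d]` (`c < d`) then `∫_c^d log g(y) dy ≤ (d − c) · log((d − c)⁻¹ ∫_c^d g(y) dy)`. [folklore] -/
theorem integral_log_le_mul_log_average (hcd : c < d) {g : ℝ → ℝ} (hg : ContinuousOn g (Icc c d))
    (hpos : ∀ y ∈ Icc c d, 0 < g y) :
    ∫ y in c..d, Real.log (g y) ≤ (d - c) * Real.log ((d - c)⁻¹ * ∫ y in c..d, g y) := by
  -- a positive lower bound for `g`
  obtain ⟨y₀, hy₀, hmin⟩ := (isCompact_Icc (a := c) (b := d)).exists_isMinOn
    (nonempty_Icc.2 hcd.le) hg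
  set m := g y₀ with hm
  have hm0 : 0 < m := hpos y₀ hy₀
  have hgm : ∀ y ∈ Icc c d, m ≤ g y := fun y hy ↦ hmin hy
  -- Jensen for the concave `log` on the closed convex set `[m, ∞)`
  have hconc : ConcaveOn ℝ (Ici m) Real.log :=
    strictConcaveOn_log_Ioi.concaveOn.subset (Ici_subset_Ioi.2 hm0) (convex_Ici m)
  have hcont : ContinuousOn Real.log (Ici m) :=
    Real.continuousOn_log.mono fun x hx ↦ (hm0.trans_le hx).ne'
  have hvol : volume (Icc c d) = ENNReal.ofReal (d - c) := Real.volume_Icc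
  have hne : volume (Icc c d) ≠ 0 := by
    rw [hvol]; exact (ENNReal.ofReal_pos.2 (sub_pos.2 hcd)).ne'
  have htop : volume (Icc c d) ≠ ⊤ := by rw [hvol]; exact ENNReal.ofReal_ne_top
  have hfs : ∀ᵐ y ∂(volume.restrict (Icc c d)), g y ∈ Ici m :=
    ae_restrict_of_forall_mem measurableSet_Icc fun y hy ↦ hgm y hy
  have hlogc : ContinuousOn (fun y ↦ Real.log (g y)) (Icc c d) :=
    hg.log fun y hy ↦ (hpos y hy).ne'
  have hJ := ConcaveOn.le_map_set_average (μ := volume) (t := Icc c d) (f := g) hconc hcont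
    isClosed_Ici hne htop hfs hg.integrableOn_Icc hlogc.integrableOn_Icc
  have hreal : volume.real (Icc c d) = d - c := by
    rw [measureReal_def, hvol, ENNReal.toReal_ofReal (sub_pos.2 hcd).le]
  rw [setAverage_eq, setAverage_eq, hreal, smul_eq_mul, smul_eq_mul,
    integral_Icc_eq_integral_Ioc, integral_Icc_eq_integral_Ioc,
    ← intervalIntegral.integral_of_le hcd.le, ← intervalIntegral.integral_of_le hcd.le] at hJ
  have hdc : 0 < d - c := sub_pos.2 hcd
  rw [inv_mul_le_iff₀ hdc] at hJ
  exact hJ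

/-- **Mean square bounds `∫ log`.** If `F : ℝ → ℂ` is continuous and non-vanishing on `[c,d]`
(`c < d`) and `∫_c^d ‖F(y)‖² dy ≤ (d − c) M`, then `∫_c^d log‖F(y)‖ dy ≤ ((d − c)/2) log M`.
[cite: Titchmarsh1986, §9.16] -/
theorem integral_log_norm_le_of_sq_integral_le (hcd : c < d) {F : ℝ → ℂ}
    (hF : ContinuousOn F (Icc c d)) (h0 : ∀ y ∈ Icc c d, F y ≠ 0) {M : ℝ}
    (hM : ∫ y in c..d, ‖F y‖ ^ 2 ≤ (d - c) * M) :
    ∫ y in c..d, Real.log ‖F y‖ ≤ (d - c) / 2 * Real.log M := by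
  have hdc : 0 < d - c := sub_pos.2 hcd
  have hg : ContinuousOn (fun y ↦ ‖F y‖ ^ 2) (Icc c d) := (hF.norm).pow 2
  have hpos : ∀ y ∈ Icc c d, 0 < ‖F y‖ ^ 2 := fun y hy ↦ by
    have := norm_pos_iff.2 (h0 y hy); positivity
  have hJ := integral_log_le_mul_log_average hcd hg hpos
  -- `log ‖F‖² = 2 log ‖F‖`
  have hlog2 : ∫ y in c..d, Real.log (‖F y‖ ^ 2) = 2 * ∫ y in c..d, Real.log ‖F y‖ := by
    rw [← intervalIntegral.integral_const_mul]
    refine intervalIntegral.integral_congr fun y _ ↦ ?_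
    simp only [Real.log_pow, Nat.cast_ofNat]
  rw [hlog2] at hJ
  -- the average of `‖F‖²` is positive and at most `M`
  have hIpos : 0 < ∫ y in c..d, ‖F y‖ ^ 2 :=
    intervalIntegral.intervalIntegral_pos_of_pos_on (hg.intervalIntegrable_of_Icc hcd.le)
      (fun y hy ↦ hpos y (Ioo_subset_Icc_self hy)) hcd
  have havg_pos : 0 < (d - c)⁻¹ * ∫ y in c..d, ‖F y‖ ^ 2 := by positivity
  have havg_le : (d - c)⁻¹ * ∫ y in c..d, ‖F y‖ ^ 2 ≤ M := by
    rw [inv_mul_le_iff₀ hdc]; exact hM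
  have hlogle : Real.log ((d - c)⁻¹ * ∫ y in c..d, ‖F y‖ ^ 2) ≤ Real.log M :=
    Real.log_le_log havg_pos havg_le
  nlinarith [mul_le_mul_of_nonneg_left hlogle hdc.le]

/-! ### The zero-density skeleton -/

/-- **Littlewood's lemma with a mean square** (the first half of the proof of Titchmarsh's
Theorem 9.16). Let `f` be analytic at every point of `R = [a,b] × [c,d]` (`a < b`, `c < d`) and
non-zero on `∂R`; suppose `∫_c^d ‖f(a+iy)‖² dy ≤ (d − c) M`, `‖f‖ ≥ m₀ > 0` on the right edge,
and that the changes of `arg f` along the top and bottom edges (from the right corner) are at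
most `A` and up the right edge at most `B` in absolute value. Then
`2π Σ_{ρ ∈ R°, f(ρ)=0} m(ρ)(Re ρ − a) ≤ (d − c)(½ log M − log m₀) + (b − a)(2A + B)`.
[cite: Titchmarsh1986, §9.16] -/
theorem littlewood_sum_le_of_sq_integral_le {f : ℂ → ℂ} (hab : a < b) (hcd : c < d)
    (hf : AnalyticOnNhd ℂ f (Icc a b ×ℂ Icc c d))
    (h_bot : ∀ x ∈ Icc a b, f (x + c * I) ≠ 0) (h_top : ∀ x ∈ Icc a b, f (x + d * I) ≠ 0)
    (h_left : ∀ y ∈ Icc c d, f (a + y * I) ≠ 0) (h_right : ∀ y ∈ Icc c d, f (b + y * I) ≠ 0)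
    {M m₀ A B : ℝ} (hM : ∫ y : ℝ in c..d, ‖f (a + y * I)‖ ^ 2 ≤ (d - c) * M) (hm₀ : 0 < m₀)
    (hright : ∀ y ∈ Icc c d, m₀ ≤ ‖f (b + y * I)‖)
    (hA_top : ∀ x ∈ Icc a b, |(∫ u : ℝ in b..x, deriv f (u + d * I) / f (u + d * I)).im| ≤ A)
    (hA_bot : ∀ x ∈ Icc a b, |(∫ u : ℝ in b..x, deriv f (u + c * I) / f (u + c * I)).im| ≤ A)
    (hB : |(∫ y : ℝ in c..d, deriv f (b + y * I) / f (b + y * I)).re| ≤ B) :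
    2 * Real.pi * ∑ᶠ ρ ∈ {ρ : ℂ | f ρ = 0 ∧ ρ ∈ Ioo a b ×ℂ Ioo c d},
        ((meromorphicOrderAt f ρ).untop₀ : ℝ) * (ρ.re - a) ≤
      (d - c) * (Real.log M / 2 - Real.log m₀) + (b - a) * (2 * A + B) := by
  have hL := littlewood_lemma_le hab hcd hf h_bot h_top h_left h_right hA_top hA_bot hB
  -- the left edge: Jensen
  have hcont_a : ContinuousOn (fun y : ℝ ↦ f (a + y * I)) (Icc c d) := fun y hy ↦
    ((hf _ ⟨by simpa using hab.le, by simpa using hy⟩).continuousAt.comp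
      (f := fun t : ℝ ↦ (a : ℂ) + t * I) (by fun_prop)).continuousWithinAt
  have h1 := integral_log_norm_le_of_sq_integral_le hcd hcont_a h_left hM
  -- the right edge: pointwise lower bound
  have hcont_b : ContinuousOn (fun y : ℝ ↦ Real.log ‖f (b + y * I)‖) (Icc c d) := fun y hy ↦ by
    have h := (hf _ ⟨by simpa using hab.le, by simpa using hy⟩).continuousAt.comp
      (f := fun t : ℝ ↦ (b : ℂ) + t * I) (by fun_prop)
    exact ((h.norm).log (norm_ne_zero_iff.2 (h_right y hy))).continuousWithinAt
  have h2 : (d - c) * Real.log m₀ ≤ ∫ y : ℝ in c..d, Real.log ‖f (b + y * I)‖ := by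
    have := intervalIntegral.integral_mono_on hcd.le
      (intervalIntegrable_const : IntervalIntegrable (fun _ : ℝ ↦ Real.log m₀) volume c d)
      (hcont_b.intervalIntegrable_of_Icc hcd.le)
      (fun y hy ↦ Real.log_le_log hm₀ (hright y hy))
    rwa [intervalIntegral.integral_const, smul_eq_mul] at this
  linarith

/-- **Zero counting from a mean square.** In the setting of
`littlewood_sum_le_of_sq_integral_le`, for every `a < σ < b` the number of zeros of `f`, counted
with multiplicity, in `[σ, b) × (c, d)` is at most
`((d − c)(½ log M − log m₀) + (b − a)(2A + B)) / (2π(σ − a))`. [cite: Titchmarsh1986, §9.16] -/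
theorem sum_order_le_of_sq_integral_le {f : ℂ → ℂ} (hab : a < b) (hcd : c < d)
    (hf : AnalyticOnNhd ℂ f (Icc a b ×ℂ Icc c d))
    (h_bot : ∀ x ∈ Icc a b, f (x + c * I) ≠ 0) (h_top : ∀ x ∈ Icc a b, f (x + d * I) ≠ 0)
    (h_left : ∀ y ∈ Icc c d, f (a + y * I) ≠ 0) (h_right : ∀ y ∈ Icc c d, f (b + y * I) ≠ 0)
    {M m₀ A B : ℝ} (hM : ∫ y : ℝ in c..d, ‖f (a + y * I)‖ ^ 2 ≤ (d - c) * M) (hm₀ : 0 < m₀)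
    (hright : ∀ y ∈ Icc c d, m₀ ≤ ‖f (b + y * I)‖)
    (hA_top : ∀ x ∈ Icc a b, |(∫ u : ℝ in b..x, deriv f (u + d * I) / f (u + d * I)).im| ≤ A)
    (hA_bot : ∀ x ∈ Icc a b, |(∫ u : ℝ in b..x, deriv f (u + c * I) / f (u + c * I)).im| ≤ A)
    (hB : |(∫ y : ℝ in c..d, deriv f (b + y * I) / f (b + y * I)).re| ≤ B)
    {σ : ℝ} (haσ : a < σ) :
    ∑ᶠ ρ ∈ {ρ : ℂ | f ρ = 0 ∧ ρ ∈ Ico σ b ×ℂ Ioo c d}, ((meromorphicOrderAt f ρ).untop₀ : ℝ) ≤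
      ((d - c) * (Real.log M / 2 - Real.log m₀) + (b - a) * (2 * A + B)) /
        (2 * Real.pi * (σ - a)) := by
  have hcorner : ((a : ℂ) + c * I) ∈ Icc a b ×ℂ Icc c d :=
    ⟨by simpa using hab.le, by simpa using hcd.le⟩
  have h1 := sum_order_le_of_lt hab.le hcd.le hf hcorner (h_bot a ⟨le_rfl, hab.le⟩) haσ
  have h2 := littlewood_sum_le_of_sq_integral_le hab hcd hf h_bot h_top h_left h_right hM hm₀
    hright hA_top hA_bot hB
  rw [le_div_iff₀ (by positivity)]
  calc (∑ᶠ ρ ∈ {ρ : ℂ | f ρ = 0 ∧ ρ ∈ Ico σ b ×ℂ Ioo c d},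
        ((meromorphicOrderAt f ρ).untop₀ : ℝ)) * (2 * Real.pi * (σ - a))
      = 2 * Real.pi * ((σ - a) * ∑ᶠ ρ ∈ {ρ : ℂ | f ρ = 0 ∧ ρ ∈ Ico σ b ×ℂ Ioo c d},
          ((meromorphicOrderAt f ρ).untop₀ : ℝ)) := by ring
    _ ≤ 2 * Real.pi * ∑ᶠ ρ ∈ {ρ : ℂ | f ρ = 0 ∧ ρ ∈ Ioo a b ×ℂ Ioo c d},
          ((meromorphicOrderAt f ρ).untop₀ : ℝ) * (ρ.re - a) :=
        mul_le_mul_of_nonneg_left h1 (by positivity)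
    _ ≤ _ := h2

end Literature.Analysis.Complex

end
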